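import Summits.ResolutionOfSingularities.ResolutionOfSingularities.Theorems.HomologicalConductorNoZenoSelfIntersectionStrict
import Summits.ResolutionOfSingularities.ResolutionOfSingularities.Theorems.HomologicalConductorNoZenoMinimalityCriterionResidual
import Literature.AlgebraicGeometry.Resolution.Lipman1969IntersectionMultipleHolds
import HarnessLib

/-!
# Crux `NoZenoR` (stmt-ResolutionOfSingularities-19943), facts slot: Lipman (27.3) «⇒» from (27.1) + (13.1) d) ONLY,
# and `(E²) ≤ −h⁰(E)` FACT-FREE

Route `ResolutionOfSingularities/HomologicalConductor` (cell decomp-res, hand leafhand-res-homologicalconduct-7 g0).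
OURS: AI-written, weaker than expert review; nothing here is a statement of the manuscript under review (Hironaka 2017).
Def-free; fact-parametric only where a `Lipman1969_…` binder appears.

Assembly of this hand's files at universe `0` (the instance of every consumer), with (13.1) a) supplied by the tree theorem
`Lipman1969_13_1_a_holds` and (14.1)-at-one-curve by `excCurveDegree_self_neg_factFree` (p811993):

* `excCurveDegree_self_le_neg_h0_factFree` — **`(E_η²) ≤ −h⁰(E_η)` and `h⁰(E_η) ≠ 0`, FACT-FREE**, on every desingularization
  of a two-dimensional normal Noetherian local domain;
* `three_mul_h0_le_h0_sq_of_13_1d` — `3·h0 𝓘_η ≤ h0 (𝓘_η²)` on every desingularization of a RATIONAL surface singularity,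
  modulo `Lipman1969_13_1_d_rat` ONLY (the dictionary `(E_η²) = 2·h⁰(𝓘_η) − h⁰(𝓘_η²)`);
* `three_mul_h0_lt_h0_sq_of_isMinimalResolution_of_27_1_13_1d` — **Lipman (27.3) «⇒» modulo (27.1) + (13.1) d) ONLY**;
* `isMinimalResolution_iff_criterionM_of_27_1_13_1d_4_1` — the full biconditional (27.3) modulo (27.1), (13.1) d), (4.1) and
  the first-kind clause (F) (hypothesis binder).

No crux or summit statement is proved here.
-/

noncomputable section

-- single-problem summit: the doubled namespace component `ResolutionOfSingularities` is forced
set_option linter.dupNamespace false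

open CategoryTheory AlgebraicGeometry IsLocalRing
open Literature.AlgebraicGeometry.Resolution Literature.AlgebraicGeometry.Motives

namespace Summit.ResolutionOfSingularities.ResolutionOfSingularities.Theorems.NoZeno.ExcCount.MinimalNoFirstKind

variable {S : Type} [CommRing S] [IsNoetherianRing S] [IsLocalRing S] [IsDomain S] [IsIntegrallyClosed S]
  {X : Scheme.{0}} {π : X ⟶ Spec (.of S)}

/-- **`(E_η²) ≤ −h⁰(E_η)`, FACT-FREE**: the self-intersection of an integral exceptional curve of a desingularization of a
two-dimensional normal Noetherian local domain is a NEGATIVE (`excCurveDegree_self_neg_factFree`) integer multiple of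
`h⁰(E_η)` (`Lipman1969_13_1_a_holds`), hence `≤ −h⁰(E_η)`, and `h⁰(E_η).toNat ≠ 0`.
[cite: Lipman1969, Proposition (13.1) a) (p. 223) and Lemma (14.1) (p. 224)] -/
theorem excCurveDegree_self_le_neg_h0_factFree (h2 : ringKrullDim S = 2) [IsIntegral X] [IsLocallyNoetherian X]
    (hπ : IsResolution π) {η : X} (hη : η ∈ excCurvePoints π) (hc : IsEffectiveCartier (primeDivisorIdeal η)) :
    excCurveDegree π (CartierDivisor.ofIsEffectiveCartier (primeDivisorIdeal η) hc) η ≤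
        -((h0 π (primeDivisorIdeal η)).toNat : ℤ) ∧
      (h0 π (primeDivisorIdeal η)).toNat ≠ 0 := by
  have hneg := excCurveDegree_self_neg_factFree h2 hπ hη hc
  obtain ⟨m, hm⟩ := Lipman1969_13_1_a_holds S X π hπ.isProper hπ.isRegular
    (CartierDivisor.ofIsEffectiveCartier (primeDivisorIdeal η) hc) η hη
  rw [hm] at hneg ⊢
  have hh : (0 : ℤ) ≤ ((h0 π (primeDivisorIdeal η)).toNat : ℤ) := Nat.cast_nonneg _
  have hm0 : m < 0 := by
    by_contra hm'
    exact absurd hneg (not_lt.2 (mul_nonneg (not_lt.1 hm') hh))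
  refine ⟨by nlinarith, fun h0 => ?_⟩
  rw [h0, Nat.cast_zero, mul_zero] at hneg
  exact lt_irrefl _ hneg

/-- **`3·h⁰(𝓘_η) ≤ h⁰(𝓘_η²)` on every desingularization of a rational surface singularity, modulo (13.1) d) ONLY**
(`(E_η²) = 2·h⁰(𝓘_η) − h⁰(𝓘_η²)` read against `(E_η²) ≤ −h⁰(E_η)`, fact-free).
[cite: Lipman1969, Proposition (13.1) d) (p. 223)] -/
theorem three_mul_h0_le_h0_sq_of_13_1d (h131d : Lipman1969_13_1_d_rat.{0}) (h2 : ringKrullDim S = 2)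
    (hS : HasRationalSingularity S) (hπ : IsResolution π) {η : X} (hη : η ∈ excCurvePoints π) :
    3 * h0 π (primeDivisorIdeal η) ≤ h0 π (primeDivisorIdeal η ^ 2) := by
  haveI : IsIntegral X := hπ.isIntegral_source
  haveI : IsProper π := hπ.isProper
  haveI : IsLocallyNoetherian X := LocallyOfFiniteType.isLocallyNoetherian π
  have hc : IsEffectiveCartier (primeDivisorIdeal η) :=
    isEffectiveCartier_primeDivisorIdeal_of_isRegular hπ.isRegular (hπ.coheight_eq_one_of_mem_excCurvePoints h2 hη)
  obtain ⟨hle, hh0⟩ := excCurveDegree_self_le_neg_h0_factFree h2 hπ hη hc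
  rw [h131d S h2 hS X π hπ η hη η hη hc] at hle
  rw [pow_two]
  set h := (h0 π (primeDivisorIdeal η)).toNat with hhdef
  set q := (h0 π (primeDivisorIdeal η * primeDivisorIdeal η)).toNat with hqdef
  have h3 : 3 * h ≤ q := by omega
  rcases eq_or_ne (h0 π (primeDivisorIdeal η * primeDivisorIdeal η)) ⊤ with htop | hfin
  · rw [htop]; exact le_top
  · have hfin' : h0 π (primeDivisorIdeal η) ≠ ⊤ := fun ht => hh0 (by rw [hhdef, ht, ENat.toNat_top])
    rw [← ENat.coe_toNat hfin', ← ENat.coe_toNat hfin, ← hhdef, ← hqdef]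
    exact_mod_cast h3

/-- **Lipman (27.3) «⇒» modulo (27.1) + (13.1) d) ONLY**: on a MINIMAL desingularization of a rational surface singularity
every integral exceptional curve satisfies (M) `3·h⁰(𝓘_η) < h⁰(𝓘_η²)`.
[cite: Lipman1969, Corollary (27.3) (p. 277), Theorem (27.1) (p. 275), Proposition (13.1) d) (p. 223)] -/
theorem three_mul_h0_lt_h0_sq_of_isMinimalResolution_of_27_1_13_1d (h271 : Lipman1969_27_1_reg_rat.{0})
    (h131d : Lipman1969_13_1_d_rat.{0}) (h2 : ringKrullDim S = 2) (hS : HasRationalSingularity S)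
    (hπ : IsMinimalResolution π) {η : X} (hη : η ∈ excCurvePoints π) :
    3 * h0 π (primeDivisorIdeal η) < h0 π (primeDivisorIdeal η ^ 2) :=
  three_mul_h0_lt_of_isMinimalResolution_of_le h271 h2 hS hπ hη
    (three_mul_h0_le_h0_sq_of_13_1d h131d h2 hS hπ.1 hη)

/-- **Lipman (27.3), both directions, modulo (27.1), (13.1) d), (4.1) and the first-kind clause (F)** (hypothesis binder;
= the untyped factorisation clause of (4.1) read at the last quadratic transformation).
[cite: Lipman1969, Corollary (27.3) (p. 277), Theorem (27.1) (p. 275), Theorem (4.1) (p. 204)] -/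
theorem isMinimalResolution_iff_criterionM_of_27_1_13_1d_4_1 (h271 : Lipman1969_27_1_reg_rat.{0})
    (h131d : Lipman1969_13_1_d_rat.{0}) (h41 : Lipman1969_4_1.{0}) (h2 : ringKrullDim S = 2)
    (hS : HasRationalSingularity S) (hπ : IsResolution π)
    (hF : ∀ (Y : Scheme.{0}) (g : Y ⟶ Spec (.of S)) (h : X ⟶ Y), IsResolution g → h ≫ g = π → ¬ IsIso h →
      ∃ η ∈ excCurvePoints π, h0 π (primeDivisorIdeal η ^ 2) = 3 * h0 π (primeDivisorIdeal η)) :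
    IsMinimalResolution π ↔
      ∀ η ∈ excCurvePoints π, 3 * h0 π (primeDivisorIdeal η) < h0 π (primeDivisorIdeal η ^ 2) :=
  ⟨fun hmin _η hη => three_mul_h0_lt_h0_sq_of_isMinimalResolution_of_27_1_13_1d h271 h131d h2 hS hmin hη,
    fun hM => isMinimalResolution_of_criterionM_of_firstKindClause h41 h2 hS hπ hF hM⟩

end Summit.ResolutionOfSingularities.ResolutionOfSingularities.Theorems.NoZeno.ExcCount.MinimalNoFirstKind

end
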